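import Summits.AtomisticToContinuum.FouriersLaw.Theses.PhononMeanFreePath
import Summits.AtomisticToContinuum.FouriersLaw.Theorems.BoundaryKubo.Negative.LoadBearing
import Summits.AtomisticToContinuum.FouriersLaw.Theorems.PhononMeanFreePathBoundaryKuboEnergyBalance
import Summits.AtomisticToContinuum.FouriersLaw.Theorems.PhononMeanFreePathBoundaryKuboGibbsTTCF
import Summits.AtomisticToContinuum.FouriersLaw.Theorems.PhononMeanFreePathBoundaryKuboKernelContinuity
import Summits.AtomisticToContinuum.FouriersLaw.Theorems.PhononMeanFreePathBoundaryKuboLimitExchange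
import Summits.AtomisticToContinuum.FouriersLaw.Theorems.PhononMeanFreePathBoundaryKuboSumRule
import Summits.AtomisticToContinuum.FouriersLaw.Theorems.PhononMeanFreePathBoundaryKuboUniformHarris
import Summits.AtomisticToContinuum.FouriersLaw.Theorems.PhononMeanFreePathBoundaryKuboUniformLocalMinorization
import Summits.AtomisticToContinuum.FouriersLaw.Theorems.PhononMeanFreePathBoundaryKuboUniformBallGeHalf
import Summits.AtomisticToContinuum.FouriersLaw.Theorems.PhononMeanFreePathBoundaryKuboJointFeller
import Summits.AtomisticToContinuum.FouriersLaw.Theorems.PhononMeanFreePathBoundaryKuboUniformMinorization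

/-!
# The boundary (cross-form) Kubo identity `PhononMeanFreePath.BoundaryKubo` — proved

Crux item stmt-AtomisticToContinuum-11812 of route `PhononMeanFreePath` (sub-problem `FouriersLaw`):
for `P = pinnedChain ω₂ lam β γ` (all four `> 0`), ASSUMING weak-NESS uniqueness, for every
steady-state family `μ`, every `T > 0` and every `N` (chain of `N+1` sites `0..N`, `μ₀ = P.gibbsMeasure (N+1) T`,
`K_t = P.transitionKernel (N+1) T T t` the constructed equal-temperature kernels, `C_N(t) = Cov_{μ₀}(p_0², K_t p_N²)`):
`C_N ∈ L¹(0,∞)` and `totalCurrent(μ (N+1) (T+δ/2) (T-δ/2))/δ → N·(γ²/T²)·∫₀^∞ C_N` as `δ → 0`, `δ ≠ 0`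
(existence AND value of Bonetto–Lebowitz–Rey-Bellet's response coefficient `D_{N+1}` at fixed `N`).

Line `gibbs-ttcf` (Cruxes/BoundaryKubo/Lines/gibbs_ttcf.lean; lead prover + stub workers, 2026-08-16): put `δ` on the
DYNAMICS and keep the MEASURE explicit. The exact finite-time Gibbs-tested transient time-correlation identity
`μ₀(K^δ_S p_N²) - μ₀(p_N²) = δ(γ/2T²)∫₀^S μ₀((p_0²-p_N²)K^δ_s p_N²) ds` (`stub_gibbsTTCF`, Lebesgue duality of the
Langevin kernels + Dynkin for the anti-friction kernels on the Gibbs density), `S → ∞` and then `δ → 0` INSIDE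
(`stub_limitExchange`: kernel continuity in the temperatures `stub_kernelContinuity`, dominated by Harris constants
LOCALLY UNIFORM in the bath temperatures `stub_uniformHarris_of_minorization` ∘ `stub_uniformMinorization_of` ∘
(`stub_uniformLocalMinorization`, `stub_uniformBallGeHalf`, `stub_jointFeller`) — CEHR 2018 Thm 2.13 (2.5) and
Prop. 3.6 re-threaded with explicit constants), closed by the energy balance
`totalCurrent(ν) = Nγ(ν(p_N²) - T_R)` in a weak steady state with an exponential moment (`stub_energyBalance`) and the
equilibrium sum rule `∫₀^∞ Cov(p_N²,K_tp_N²) + ∫₀^∞ Cov(p_0²,K_tp_N²) = T²/γ` (`stub_sumRule`, duality + Doob–Dynkin for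
`H`, no detailed balance): `totalCurrent/δ → Nγ[(γ/2T²)(∫Y-∫X) + ½] = N(γ²/T²)∫Y`.
All ten stub files are `Theorems/PhononMeanFreePathBoundaryKubo*.lean`
(namespace `Summit.AtomisticToContinuum.FouriersLaw.Theorems.BoundaryKubo.GibbsTtcf`); this file is the composition.
-/

noncomputable section

open scoped NNReal ENNReal Topology
open MeasureTheory Filter Set

namespace Summit.AtomisticToContinuum.FouriersLaw.Theorems.PhononMeanFreePathBoundaryKubo

open Literature.MathematicalPhysics.KineticTheory.HeatConduction
open Summit.AtomisticToContinuum.FouriersLaw.Theorems.BoundaryKubo.Negative.LoadBearing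
  (kuboIntegrand kuboValue LimitClause UniqueSteady SteadyFamily boundaryKubo_iff)
open Summit.AtomisticToContinuum.FouriersLaw.Theorems.BoundaryKubo.GibbsTtcf

/-- **The boundary Kubo identity (crux `BoundaryKubo` of route `PhononMeanFreePath`), proved.** Under weak-NESS
uniqueness, along every steady-state family of the pinned anharmonic chain, for every `T > 0` and `N`: the cross-form
Kubo integrand `C_N` is integrable on `(0,∞)` and the symmetric-protocol response quotient
`totalCurrent(μ (N+1) (T+δ/2) (T-δ/2))/δ` converges to `N·(γ²/T²)·∫₀^∞ C_N` as `δ → 0`, `δ ≠ 0`. Composition of the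
ten landed stubs of line `gibbs-ttcf`: uniform minorisation → locally uniform Harris → (with the Gibbs TTCF identity
and kernel continuity) the response of the end kinetic temperature `(μ_δ(p_N²) - T)/δ → (γ/2T²)(∫Y - ∫X)`; energy
balance (for `0 < |δ| ≤ δ₀` the family member IS the Harris steady state, by the crux's uniqueness) rewrites
`totalCurrent(μ_δ)/δ = Nγ(μ_δ(p_N²) - T)/δ + Nγ/2` eventually; the sum rule `∫X + ∫Y = T²/γ` gives the value and the
integrability clause. [cite: CuneoEckmannHairerReyBellet2018, Thm 2.13] -/
theorem boundaryKubo_proof :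
    Summit.AtomisticToContinuum.FouriersLaw.Theses.PhononMeanFreePath.BoundaryKubo := by
  -- the four inputs of the composition, from the landed stubs
  have h1 := stub_uniformHarris_of_minorization
    (stub_uniformMinorization_of stub_uniformLocalMinorization stub_uniformBallGeHalf stub_jointFeller)
  have h4 := stub_limitExchange h1 stub_gibbsTTCF stub_kernelContinuity
  have h5 := stub_sumRule
  have h6 := stub_energyBalance
  rw [boundaryKubo_iff]
  intro ω₂ lam β γ hω hl hβ hγ hU μ hμ T hT N
  obtain ⟨hY, hX, hsum⟩ := h5 ω₂ lam β γ hω hl hβ hγ N T hT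
  refine ⟨hY, ?_⟩
  have hT0 : T ≠ 0 := hT.ne'
  have hγ0 : γ ≠ 0 := hγ.ne'
  -- the response of the end kinetic temperature
  have hresp := h4 ω₂ lam β γ hω hl hβ hγ hU μ hμ T hT N
  -- the window `|δ| ≤ δ₀` and the exponential moment of the steady states in it
  obtain ⟨δ₀, θ, C, c, hδ₀, hδ₀T, hθ, -, -, -, hH⟩ := h1 ω₂ lam β γ hω hl hβ hγ N T hT
  -- energy balance along the family, eventually: totalCurrent/δ = Nγ·(μ_δ(p_N²) - T)/δ + Nγ/2
  have hev : (fun δ : ℝ => (N : ℝ) * γ *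
        (((∫ z, (z.2 (Fin.last N)) ^ 2 ∂(μ (N + 1) (T + δ / 2) (T - δ / 2))) - T) / δ) +
        (N : ℝ) * γ / 2) =ᶠ[𝓝[≠] (0 : ℝ)]
      fun δ => (pinnedChain ω₂ lam β γ).totalCurrent (μ (N + 1) (T + δ / 2) (T - δ / 2)) / δ := by
    have hnhds : Icc (-δ₀) δ₀ ∈ 𝓝[≠] (0 : ℝ) :=
      mem_nhdsWithin_of_mem_nhds (Icc_mem_nhds (by linarith) hδ₀)
    filter_upwards [hnhds, self_mem_nhdsWithin] with δ hδ hne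
    have hne' : δ ≠ 0 := Set.mem_compl_singleton_iff.mp hne
    have hδ' : |δ| ≤ δ₀ := abs_le.mpr ⟨hδ.1, hδ.2⟩
    have hL : 0 < T + δ / 2 := by linarith [hδ.1]
    have hR : 0 < T - δ / 2 := by linarith [hδ.2]
    obtain ⟨ν, hνst, hνint, -⟩ := hH δ hδ'
    have heq : μ (N + 1) (T + δ / 2) (T - δ / 2) = ν :=
      hU (N + 1) _ _ hL hR _ _ (hμ (N + 1) _ _ hL hR) hνst
    have hbal := h6 ω₂ lam β γ hω hl hβ hγ N (T + δ / 2) (T - δ / 2) hL hR ν hνst ⟨θ, hθ, hνint⟩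
    show (N : ℝ) * γ * (((∫ z, (z.2 (Fin.last N)) ^ 2 ∂(μ (N + 1) (T + δ / 2) (T - δ / 2))) - T) / δ) +
        (N : ℝ) * γ / 2 =
      (pinnedChain ω₂ lam β γ).totalCurrent (μ (N + 1) (T + δ / 2) (T - δ / 2)) / δ
    rw [heq, hbal]
    field_simp
    ring
  -- the limit of the left-hand side, and its value
  have hlim : Tendsto (fun δ : ℝ => (N : ℝ) * γ *
        (((∫ z, (z.2 (Fin.last N)) ^ 2 ∂(μ (N + 1) (T + δ / 2) (T - δ / 2))) - T) / δ) +
        (N : ℝ) * γ / 2) (𝓝[≠] (0 : ℝ))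
      (𝓝 ((N : ℝ) * γ * (γ / (2 * T ^ 2) * ((∫ t in Ioi (0 : ℝ), kuboIntegrand ω₂ lam β γ T N t) -
        (∫ t in Ioi (0 : ℝ), ((∫ z, (z.2 (Fin.last N)) ^ 2 * (∫ y, (y.2 (Fin.last N)) ^ 2
              ∂((pinnedChain ω₂ lam β γ).transitionKernel (N + 1) T T t.toNNReal z))
              ∂((pinnedChain ω₂ lam β γ).gibbsMeasure (N + 1) T)) -
            (∫ z, (z.2 (Fin.last N)) ^ 2 ∂((pinnedChain ω₂ lam β γ).gibbsMeasure (N + 1) T)) *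
              (∫ z, (∫ y, (y.2 (Fin.last N)) ^ 2
                ∂((pinnedChain ω₂ lam β γ).transitionKernel (N + 1) T T t.toNNReal z))
                ∂((pinnedChain ω₂ lam β γ).gibbsMeasure (N + 1) T)))))) + (N : ℝ) * γ / 2)) :=
    (hresp.const_mul ((N : ℝ) * γ)).add tendsto_const_nhds
  have hval : (N : ℝ) * γ * (γ / (2 * T ^ 2) * ((∫ t in Ioi (0 : ℝ), kuboIntegrand ω₂ lam β γ T N t) -
        (∫ t in Ioi (0 : ℝ), ((∫ z, (z.2 (Fin.last N)) ^ 2 * (∫ y, (y.2 (Fin.last N)) ^ 2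
              ∂((pinnedChain ω₂ lam β γ).transitionKernel (N + 1) T T t.toNNReal z))
              ∂((pinnedChain ω₂ lam β γ).gibbsMeasure (N + 1) T)) -
            (∫ z, (z.2 (Fin.last N)) ^ 2 ∂((pinnedChain ω₂ lam β γ).gibbsMeasure (N + 1) T)) *
              (∫ z, (∫ y, (y.2 (Fin.last N)) ^ 2
                ∂((pinnedChain ω₂ lam β γ).transitionKernel (N + 1) T T t.toNNReal z))
                ∂((pinnedChain ω₂ lam β γ).gibbsMeasure (N + 1) T)))))) + (N : ℝ) * γ / 2 =
      kuboValue ω₂ lam β γ T N := by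
    have hIX' : (∫ t in Ioi (0 : ℝ), ((∫ z, (z.2 (Fin.last N)) ^ 2 * (∫ y, (y.2 (Fin.last N)) ^ 2
              ∂((pinnedChain ω₂ lam β γ).transitionKernel (N + 1) T T t.toNNReal z))
              ∂((pinnedChain ω₂ lam β γ).gibbsMeasure (N + 1) T)) -
            (∫ z, (z.2 (Fin.last N)) ^ 2 ∂((pinnedChain ω₂ lam β γ).gibbsMeasure (N + 1) T)) *
              (∫ z, (∫ y, (y.2 (Fin.last N)) ^ 2
                ∂((pinnedChain ω₂ lam β γ).transitionKernel (N + 1) T T t.toNNReal z))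
                ∂((pinnedChain ω₂ lam β γ).gibbsMeasure (N + 1) T)))) =
        T ^ 2 / γ - (∫ t in Ioi (0 : ℝ), kuboIntegrand ω₂ lam β γ T N t) := by
      linarith
    show _ = (N : ℝ) * (γ ^ 2 / T ^ 2) * (∫ t in Ioi (0 : ℝ), kuboIntegrand ω₂ lam β γ T N t)
    rw [hIX']
    field_simp
    ring
  rw [hval] at hlim
  unfold LimitClause
  exact hlim.congr' hev

end Summit.AtomisticToContinuum.FouriersLaw.Theorems.PhononMeanFreePathBoundaryKubo

end
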